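import Mathlib
import HarnessLib
import Summits.ValiantsHypothesis.ValiantsHypothesis.Theorems.LacunarySymmetroidMatrixDescartesProductPlusOneLogConvexAlgebra
import Summits.ValiantsHypothesis.ValiantsHypothesis.Theorems.LacunarySymmetroidMatrixDescartesProductPlusOneCloudCalculus
import Summits.ValiantsHypothesis.ValiantsHypothesis.Theorems.LacunarySymmetroidMatrixDescartesProductPlusOneCloudDefs
import Summits.ValiantsHypothesis.ValiantsHypothesis.Theorems.LacunarySymmetroidMatrixDescartesProductPlusOneOneRiserTower

/-!
# LINE (A) `product_plus_one` — ★★ the one-riser lemma against ANY cloud of unswitched incoherent trinomials (kernel form of memo §11)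

Crux item stmt-ValiantsHypothesis-18050, LINE (A) floor structure (memo `pub/val-lit/lmr/NOTE-p7g15-18050-LINEA-incoherent-cell.md` §11–§12).
Cloud: rows `A_i − B_i x^p − C_i x^q` (`B_i, C_i ≥ 0`, `B_i + C_i > 0`, weights `m_i > 0`), unswitched on `[x₁, x₄] ⊂ (0, ∞)`; pull
`cloudP0 = Σ_i m_i ψ_i`, `ψ_i = rowPsi0 = (p B_i x^p + q C_i x^q)/(A_i − B_i x^p − C_i x^q)` (closed forms: ✓ `…CloudDefs`).  Riser `a − b x^p − c x^q`
(`b, c > 0`, `a` free) switched there.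

* `hasDerivAt_rowPsi0/1/2`, `cloud_hasDerivAt0/1/2` — the θ-tower of a row / of the cloud in the named closed forms (✓ `…CloudCalculus`);
* `row_*` — per-row signs and the log-convexity of the triples `(ψ, θψ, θ²ψ)` and `(A0, A1, A2)` (✓ `lc_psi`, `lc_inv`, `lc_mul`, `lc_posynomial2`);
* `cloud_P0_pos`, `cloud_P1_pos`, `cloud_lcP`, `cloud_N_pos`, `cloud_lcN` — the hypotheses of ✓ `oneRiser_no_four_zeros_of_tower`, series-free;
* ★★ `oneRiser_no_four_zeros_trinomialCloud` — `P/(b x^p + c x^q − a) − cloudP0` has no four zeros on the interval: AT MOST THREE, uniformly in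
  `p < q`, the cloud and all coefficients.  (Binomial rows `C_i = 0` or `B_i = 0` included: the first gap of every T5-all member.)

Honest framing: a located STRUCTURE theorem of the floor; NOT `OneChangeFloorK3` / `stub_classRowK3` / `stub_polyLaw` / `MatrixDescartes` / B;
`VP ≠ VNP` NOT proved.  No definitions (those are in `…CloudDefs`), no named facts; Mathlib only.
-/

set_option linter.dupNamespace false

namespace Summit.ValiantsHypothesis.ValiantsHypothesis.Theorems.LacunarySymmetroidMatrixDescartes

namespace ProductPlusOne

open Finset
open scoped BigOperators

/-! ### §1 One row: the tower in named form, signs, log-convexity -/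

section Row

variable (e₁ e₂ : ℕ) (A B C : ℝ)

/-- `d/dx ψ = θψ/x` in named form. -/
theorem hasDerivAt_rowPsi0 {x : ℝ} (hx : x ≠ 0) (hF : A - B * x ^ (e₁ + 1) - C * x ^ (e₁ + e₂ + 2) ≠ 0) :
    HasDerivAt (rowPsi0 e₁ e₂ A B C) (rowPsi1 e₁ e₂ A B C x / x) x := by
  have h := hasDerivAt_psi0 e₁ e₂ A B C hx hF
  refine (h.congr_of_eventuallyEq (Filter.Eventually.of_forall fun t => ?_)).congr_deriv ?_
  · simp only [rowPsi0, rowH, rowU, pow_one]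
  · simp only [rowPsi1, rowH, rowU, pow_one]

/-- `d/dx θψ = θ²ψ/x` in named form. -/
theorem hasDerivAt_rowPsi1 {x : ℝ} (hx : x ≠ 0) (hF : A - B * x ^ (e₁ + 1) - C * x ^ (e₁ + e₂ + 2) ≠ 0) :
    HasDerivAt (rowPsi1 e₁ e₂ A B C) (rowPsi2 e₁ e₂ A B C x / x) x := by
  have h := hasDerivAt_psi1 e₁ e₂ A B C hx hF
  refine (h.congr_of_eventuallyEq (Filter.Eventually.of_forall fun t => ?_)).congr_deriv ?_
  · simp only [rowPsi1, rowH, rowU, pow_one]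
  · simp only [rowPsi2, rowH, rowU, pow_one]

/-- `d/dx θ²ψ = θ³ψ/x` in named form. -/
theorem hasDerivAt_rowPsi2 {x : ℝ} (hx : x ≠ 0) (hF : A - B * x ^ (e₁ + 1) - C * x ^ (e₁ + e₂ + 2) ≠ 0) :
    HasDerivAt (rowPsi2 e₁ e₂ A B C) (rowPsi3 e₁ e₂ A B C x / x) x := by
  have h := hasDerivAt_psi2 e₁ e₂ A B C hx hF
  refine (h.congr_of_eventuallyEq (Filter.Eventually.of_forall fun t => ?_)).congr_deriv ?_
  · simp only [rowPsi2, rowH, rowU, pow_one]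
  · simp only [rowPsi3, rowH, rowU, pow_one]

/-- `H_k ≥ 0` for `B, C ≥ 0`, `x > 0`. -/
theorem rowH_nonneg (k : ℕ) {x : ℝ} (hx : 0 < x) (hB : 0 ≤ B) (hC : 0 ≤ C) : 0 ≤ rowH e₁ e₂ k B C x := by
  unfold rowH; positivity

/-- `H₁ > 0` for a genuine row (`B + C > 0`). -/
theorem rowH_one_pos {x : ℝ} (hx : 0 < x) (hB : 0 ≤ B) (hC : 0 ≤ C) (hBC : 0 < B + C) : 0 < rowH e₁ e₂ 1 B C x := by
  unfold rowH
  have hX : 0 < x ^ (e₁ + 1) := pow_pos hx _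
  have hY : 0 < x ^ (e₁ + e₂ + 2) := pow_pos hx _
  have h1 : 0 < ((e₁ : ℝ) + 1) ^ 1 * x ^ (e₁ + 1) := by positivity
  have h2 : 0 < ((e₁ : ℝ) + e₂ + 2) ^ 1 * x ^ (e₁ + e₂ + 2) := by positivity
  rcases lt_or_ge 0 B with hBp | hBz
  · nlinarith [mul_pos h1 hBp, mul_nonneg h2.le hC]
  · have hCp : 0 < C := by linarith
    nlinarith [mul_pos h2 hCp, mul_nonneg h1.le hB]

/-- `H₂² ≤ H₁H₃` (the posynomial `θh` is log-convex in `log x`). -/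
theorem rowH_lc {x : ℝ} (hx : 0 < x) (hB : 0 ≤ B) (hC : 0 ≤ C) :
    rowH e₁ e₂ 2 B C x ^ 2 ≤ rowH e₁ e₂ 1 B C x * rowH e₁ e₂ 3 B C x := by
  unfold rowH
  have h := lc_posynomial2 (((e₁ : ℝ) + 1) * B) (((e₁ : ℝ) + e₂ + 2) * C) (x ^ (e₁ + 1)) (x ^ (e₁ + e₂ + 2))
    ((e₁ : ℝ) + 1) ((e₁ : ℝ) + e₂ + 2) (by positivity) (by positivity) (pow_pos hx _).le (pow_pos hx _).le
  convert h using 2 <;> ring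

/-- `u > 0` for an unswitched row. -/
theorem rowU_pos {x : ℝ} (hF : 0 < A - B * x ^ (e₁ + 1) - C * x ^ (e₁ + e₂ + 2)) : 0 < rowU e₁ e₂ A B C x := by
  unfold rowU; exact inv_pos.2 hF

/-- Signs of the tower: `ψ ≥ 0`, `θψ > 0`, `θ²ψ ≥ 0` (genuine unswitched row, `x > 0`). -/
theorem rowPsi_signs {x : ℝ} (hx : 0 < x) (hB : 0 ≤ B) (hC : 0 ≤ C) (hBC : 0 < B + C)
    (hF : 0 < A - B * x ^ (e₁ + 1) - C * x ^ (e₁ + e₂ + 2)) :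
    0 ≤ rowPsi0 e₁ e₂ A B C x ∧ 0 < rowPsi1 e₁ e₂ A B C x ∧ 0 ≤ rowPsi2 e₁ e₂ A B C x := by
  have hu := rowU_pos e₁ e₂ A B C hF
  have h1 := rowH_one_pos e₁ e₂ B C hx hB hC hBC
  have h2 := rowH_nonneg e₁ e₂ B C 2 hx hB hC
  have h3 := rowH_nonneg e₁ e₂ B C 3 hx hB hC
  refine ⟨by unfold rowPsi0; positivity, ?_, by unfold rowPsi2; positivity⟩
  unfold rowPsi1
  have : 0 < rowH e₁ e₂ 1 B C x ^ 2 * rowU e₁ e₂ A B C x ^ 2 := by positivity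
  nlinarith [mul_nonneg h2 hu.le]

/-- The row's triple `(ψ, θψ, θ²ψ)` is log-convex. -/
theorem rowPsi_lc {x : ℝ} (hx : 0 < x) (hB : 0 ≤ B) (hC : 0 ≤ C) (hF : 0 < A - B * x ^ (e₁ + 1) - C * x ^ (e₁ + e₂ + 2)) :
    rowPsi1 e₁ e₂ A B C x ^ 2 ≤ rowPsi0 e₁ e₂ A B C x * rowPsi2 e₁ e₂ A B C x := by
  unfold rowPsi0 rowPsi1 rowPsi2
  exact lc_psi _ _ _ _ (rowU_pos e₁ e₂ A B C hF) (rowH_nonneg e₁ e₂ B C 2 hx hB hC) (rowH_lc e₁ e₂ B C hx hB hC)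

/-- `θψ − pψ = G·u + ψ²·0 + …`: precisely `p·ψ ≤ θψ` (because `H₂ − pH₁ = q(q−p)C x^q ≥ 0`). -/
theorem rowPsi1_ge {x : ℝ} (hx : 0 < x) (hC : 0 ≤ C) (hF : 0 < A - B * x ^ (e₁ + 1) - C * x ^ (e₁ + e₂ + 2)) :
    ((e₁ : ℝ) + 1) * rowPsi0 e₁ e₂ A B C x ≤ rowPsi1 e₁ e₂ A B C x := by
  have hu := rowU_pos e₁ e₂ A B C hF
  unfold rowPsi0 rowPsi1 rowH
  have hY : 0 ≤ x ^ (e₁ + e₂ + 2) := (pow_pos hx _).le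
  have hG : 0 ≤ ((e₁ : ℝ) + e₂ + 2) * ((e₂ : ℝ) + 1) * C * x ^ (e₁ + e₂ + 2) * rowU e₁ e₂ A B C x := by positivity
  nlinarith [sq_nonneg ((((e₁ : ℝ) + 1) ^ 1 * B * x ^ (e₁ + 1) + ((e₁ : ℝ) + e₂ + 2) ^ 1 * C * x ^ (e₁ + e₂ + 2)) * rowU e₁ e₂ A B C x)]

/-- The `A`-triple of a row (`A0 = (θψ − pψ) − ψ² = G·u`, `G = q(q−p)C x^q`) and its log-convexity, with the bookkeeping identities
`A0 + ψ² = θψ − pψ`, `A1 + 2ψθψ = θ²ψ − pθψ`, `A2 + 2(θψ)² + 2ψθ²ψ = θ³ψ − pθ²ψ`. -/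
theorem rowA_lc {x : ℝ} (hx : 0 < x) (hB : 0 ≤ B) (hC : 0 ≤ C) (hF : 0 < A - B * x ^ (e₁ + 1) - C * x ^ (e₁ + e₂ + 2)) :
    let p : ℝ := (e₁ : ℝ) + 1
    let A0 := rowPsi1 e₁ e₂ A B C x - p * rowPsi0 e₁ e₂ A B C x - rowPsi0 e₁ e₂ A B C x ^ 2
    let A1 := rowPsi2 e₁ e₂ A B C x - p * rowPsi1 e₁ e₂ A B C x - 2 * rowPsi0 e₁ e₂ A B C x * rowPsi1 e₁ e₂ A B C x
    let A2 := rowPsi3 e₁ e₂ A B C x - p * rowPsi2 e₁ e₂ A B C x - 2 * rowPsi1 e₁ e₂ A B C x ^ 2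
      - 2 * rowPsi0 e₁ e₂ A B C x * rowPsi2 e₁ e₂ A B C x
    0 ≤ A0 ∧ 0 ≤ A2 ∧ A1 ^ 2 ≤ A0 * A2 := by
  intro p A0 A1 A2
  have hu := rowU_pos e₁ e₂ A B C hF
  set u := rowU e₁ e₂ A B C x with hudef
  set q : ℝ := (e₁ : ℝ) + e₂ + 2 with hq
  set G : ℝ := q * (q - p) * C * x ^ (e₁ + e₂ + 2) with hG
  have hqp : 0 ≤ q - p := by simp only [hq, p]; linarith [(Nat.cast_nonneg e₂ : (0 : ℝ) ≤ e₂)]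
  have hGnn : 0 ≤ G := by simp only [hG]; positivity
  have hH1 := rowH_nonneg e₁ e₂ B C 1 hx hB hC
  have hH2 := rowH_nonneg e₁ e₂ B C 2 hx hB hC
  -- the named forms
  have eA0 : A0 = G * u := by
    simp only [A0, p, hG, hq, rowPsi0, rowPsi1, rowH, hudef]; ring
  have eA1 : A1 = q * G * u + G * (rowH e₁ e₂ 1 B C x * u ^ 2) := by
    simp only [A1, p, hG, hq, rowPsi0, rowPsi1, rowPsi2, rowH, hudef]; ring
  have eA2 : A2 = q ^ 2 * G * u + 2 * (q * G) * (rowH e₁ e₂ 1 B C x * u ^ 2)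
      + G * (rowH e₁ e₂ 2 B C x * u ^ 2 + 2 * rowH e₁ e₂ 1 B C x ^ 2 * u ^ 3) := by
    simp only [A2, p, hG, hq, rowPsi0, rowPsi1, rowPsi2, rowPsi3, rowH, hudef]; ring
  refine ⟨by rw [eA0]; positivity, by rw [eA2]; positivity, ?_⟩
  have hf : (q * G) ^ 2 ≤ G * (q ^ 2 * G) := le_of_eq (by ring)
  have hg := lc_inv u (rowH e₁ e₂ 1 B C x) (rowH e₁ e₂ 2 B C x) hu hH2
  have h := lc_mul hf hg
  rw [eA0, eA1, eA2]
  exact h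

end Row

/-! ### §2 The cloud: tower, signs, and the two log-convexity facts -/

section Cloud

variable (e₁ e₂ : ℕ) {ι : Type*} (s : Finset ι) (m A B C : ι → ℝ)

/-- `d/dx P0 = P1/x`. -/
theorem cloud_hasDerivAt0 {x : ℝ} (hx : 0 < x) (hF : ∀ i ∈ s, 0 < A i - B i * x ^ (e₁ + 1) - C i * x ^ (e₁ + e₂ + 2)) :
    HasDerivAt (cloudP0 e₁ e₂ s m A B C) (cloudP1 e₁ e₂ s m A B C x / x) x := by
  have h := HasDerivAt.fun_sum (u := s) fun i hi =>
    (hasDerivAt_rowPsi0 e₁ e₂ (A i) (B i) (C i) hx.ne' (hF i hi).ne').const_mul (m i)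
  refine (h.congr_of_eventuallyEq (Filter.Eventually.of_forall fun t => ?_)).congr_deriv ?_
  · simp only [cloudP0]
  · simp only [cloudP1, Finset.sum_div]
    exact Finset.sum_congr rfl fun i _ => by ring

/-- `d/dx P1 = P2/x`. -/
theorem cloud_hasDerivAt1 {x : ℝ} (hx : 0 < x) (hF : ∀ i ∈ s, 0 < A i - B i * x ^ (e₁ + 1) - C i * x ^ (e₁ + e₂ + 2)) :
    HasDerivAt (cloudP1 e₁ e₂ s m A B C) (cloudP2 e₁ e₂ s m A B C x / x) x := by
  have h := HasDerivAt.fun_sum (u := s) fun i hi =>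
    (hasDerivAt_rowPsi1 e₁ e₂ (A i) (B i) (C i) hx.ne' (hF i hi).ne').const_mul (m i)
  refine (h.congr_of_eventuallyEq (Filter.Eventually.of_forall fun t => ?_)).congr_deriv ?_
  · simp only [cloudP1]
  · simp only [cloudP2, Finset.sum_div]
    exact Finset.sum_congr rfl fun i _ => by ring

/-- `d/dx P2 = P3/x`. -/
theorem cloud_hasDerivAt2 {x : ℝ} (hx : 0 < x) (hF : ∀ i ∈ s, 0 < A i - B i * x ^ (e₁ + 1) - C i * x ^ (e₁ + e₂ + 2)) :
    HasDerivAt (cloudP2 e₁ e₂ s m A B C) (cloudP3 e₁ e₂ s m A B C x / x) x := by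
  have h := HasDerivAt.fun_sum (u := s) fun i hi =>
    (hasDerivAt_rowPsi2 e₁ e₂ (A i) (B i) (C i) hx.ne' (hF i hi).ne').const_mul (m i)
  refine (h.congr_of_eventuallyEq (Filter.Eventually.of_forall fun t => ?_)).congr_deriv ?_
  · simp only [cloudP2]
  · simp only [cloudP3, Finset.sum_div]
    exact Finset.sum_congr rfl fun i _ => by ring

variable {s m A B C}

/-- `P0 > 0`, `P1 > 0`, `p·P0 ≤ P1`, hence `N = P0² + P1 − pP0 > 0`. -/
theorem cloud_signs {x : ℝ} (hx : 0 < x) (hs : s.Nonempty) (hm : ∀ i ∈ s, 0 < m i) (hB : ∀ i ∈ s, 0 ≤ B i)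
    (hC : ∀ i ∈ s, 0 ≤ C i) (hBC : ∀ i ∈ s, 0 < B i + C i)
    (hF : ∀ i ∈ s, 0 < A i - B i * x ^ (e₁ + 1) - C i * x ^ (e₁ + e₂ + 2)) :
    0 < cloudP0 e₁ e₂ s m A B C x ∧ 0 < cloudP1 e₁ e₂ s m A B C x ∧
      ((e₁ : ℝ) + 1) * cloudP0 e₁ e₂ s m A B C x ≤ cloudP1 e₁ e₂ s m A B C x ∧
      0 < cloudP0 e₁ e₂ s m A B C x ^ 2 + cloudP1 e₁ e₂ s m A B C x - ((e₁ : ℝ) + 1) * cloudP0 e₁ e₂ s m A B C x := by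
  have hP0 : 0 < cloudP0 e₁ e₂ s m A B C x := by
    unfold cloudP0
    refine Finset.sum_pos (fun i hi => mul_pos (hm i hi) ?_) hs
    unfold rowPsi0
    exact mul_pos (rowH_one_pos e₁ e₂ (B i) (C i) hx (hB i hi) (hC i hi) (hBC i hi)) (rowU_pos e₁ e₂ (A i) (B i) (C i) (hF i hi))
  have hP1 : 0 < cloudP1 e₁ e₂ s m A B C x := by
    unfold cloudP1
    exact Finset.sum_pos (fun i hi => mul_pos (hm i hi) (rowPsi_signs e₁ e₂ (A i) (B i) (C i) hx (hB i hi) (hC i hi) (hBC i hi) (hF i hi)).2.1) hs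
  have hge : ((e₁ : ℝ) + 1) * cloudP0 e₁ e₂ s m A B C x ≤ cloudP1 e₁ e₂ s m A B C x := by
    unfold cloudP0 cloudP1
    rw [Finset.mul_sum]
    refine Finset.sum_le_sum fun i hi => ?_
    have := rowPsi1_ge e₁ e₂ (A i) (B i) (C i) hx (hC i hi) (hF i hi)
    nlinarith [hm i hi]
  exact ⟨hP0, hP1, hge, by nlinarith⟩

/-- The pull is log-convex in `log x`: `P1² ≤ P0·P2`. -/
theorem cloud_lcP {x : ℝ} (hx : 0 < x) (hm : ∀ i ∈ s, 0 < m i) (hB : ∀ i ∈ s, 0 ≤ B i) (hC : ∀ i ∈ s, 0 ≤ C i)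
    (hBC : ∀ i ∈ s, 0 < B i + C i) (hF : ∀ i ∈ s, 0 < A i - B i * x ^ (e₁ + 1) - C i * x ^ (e₁ + e₂ + 2)) :
    cloudP1 e₁ e₂ s m A B C x ^ 2 ≤ cloudP0 e₁ e₂ s m A B C x * cloudP2 e₁ e₂ s m A B C x := by
  unfold cloudP0 cloudP1 cloudP2
  refine lc_sum s _ _ _ (fun i hi => mul_nonneg (hm i hi).le
      (rowPsi_signs e₁ e₂ (A i) (B i) (C i) hx (hB i hi) (hC i hi) (hBC i hi) (hF i hi)).1)
    (fun i hi => mul_nonneg (hm i hi).le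
      (rowPsi_signs e₁ e₂ (A i) (B i) (C i) hx (hB i hi) (hC i hi) (hBC i hi) (hF i hi)).2.2) ?_
  intro i hi
  have h := rowPsi_lc e₁ e₂ (A i) (B i) (C i) hx (hB i hi) (hC i hi) (hF i hi)
  have hm2 : 0 ≤ m i ^ 2 := sq_nonneg _
  calc (m i * rowPsi1 e₁ e₂ (A i) (B i) (C i) x) ^ 2 = m i ^ 2 * rowPsi1 e₁ e₂ (A i) (B i) (C i) x ^ 2 := by ring
    _ ≤ m i ^ 2 * (rowPsi0 e₁ e₂ (A i) (B i) (C i) x * rowPsi2 e₁ e₂ (A i) (B i) (C i) x) := mul_le_mul_of_nonneg_left h hm2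
    _ = m i * rowPsi0 e₁ e₂ (A i) (B i) (C i) x * (m i * rowPsi2 e₁ e₂ (A i) (B i) (C i) x) := by ring

/-- ★ `N = P0² + P1 − pP0` is log-convex in `log x`: `(θN)² ≤ N·θ²N`. -/
theorem cloud_lcN {x : ℝ} (hx : 0 < x) (hm : ∀ i ∈ s, 0 < m i) (hB : ∀ i ∈ s, 0 ≤ B i) (hC : ∀ i ∈ s, 0 ≤ C i)
    (hBC : ∀ i ∈ s, 0 < B i + C i) (hF : ∀ i ∈ s, 0 < A i - B i * x ^ (e₁ + 1) - C i * x ^ (e₁ + e₂ + 2)) :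
    (2 * cloudP0 e₁ e₂ s m A B C x * cloudP1 e₁ e₂ s m A B C x + cloudP2 e₁ e₂ s m A B C x
        - ((e₁ : ℝ) + 1) * cloudP1 e₁ e₂ s m A B C x) ^ 2
      ≤ (cloudP0 e₁ e₂ s m A B C x ^ 2 + cloudP1 e₁ e₂ s m A B C x - ((e₁ : ℝ) + 1) * cloudP0 e₁ e₂ s m A B C x)
        * (2 * cloudP1 e₁ e₂ s m A B C x ^ 2 + 2 * cloudP0 e₁ e₂ s m A B C x * cloudP2 e₁ e₂ s m A B C x
            + cloudP3 e₁ e₂ s m A B C x - ((e₁ : ℝ) + 1) * cloudP2 e₁ e₂ s m A B C x) := by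
  set p : ℝ := (e₁ : ℝ) + 1 with hp
  -- per-row data at `x`
  set ψ0 : ι → ℝ := fun i => rowPsi0 e₁ e₂ (A i) (B i) (C i) x with hψ0
  set ψ1 : ι → ℝ := fun i => rowPsi1 e₁ e₂ (A i) (B i) (C i) x with hψ1
  set ψ2 : ι → ℝ := fun i => rowPsi2 e₁ e₂ (A i) (B i) (C i) x with hψ2
  set ψ3 : ι → ℝ := fun i => rowPsi3 e₁ e₂ (A i) (B i) (C i) x with hψ3
  set A0 : ι → ℝ := fun i => ψ1 i - p * ψ0 i - ψ0 i ^ 2 with hA0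
  set A1 : ι → ℝ := fun i => ψ2 i - p * ψ1 i - 2 * ψ0 i * ψ1 i with hA1
  set A2 : ι → ℝ := fun i => ψ3 i - p * ψ2 i - 2 * ψ1 i ^ 2 - 2 * ψ0 i * ψ2 i with hA2
  have hrow : ∀ i ∈ s, 0 ≤ A0 i ∧ 0 ≤ A2 i ∧ A1 i ^ 2 ≤ A0 i * A2 i := fun i hi =>
    rowA_lc e₁ e₂ (A i) (B i) (C i) hx (hB i hi) (hC i hi) (hF i hi)
  have hsig : ∀ i ∈ s, 0 ≤ ψ0 i ∧ 0 < ψ1 i ∧ 0 ≤ ψ2 i := fun i hi =>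
    rowPsi_signs e₁ e₂ (A i) (B i) (C i) hx (hB i hi) (hC i hi) (hBC i hi) (hF i hi)
  have h := cloud_N_logConvex s m ψ0 ψ1 ψ2 A0 A1 A2 (fun i hi => (hm i hi).le)
    (fun i hi => (hsig i hi).1) (fun i hi => (hsig i hi).2.2)
    (fun i hi => rowPsi_lc e₁ e₂ (A i) (B i) (C i) hx (hB i hi) (hC i hi) (hF i hi))
    (fun i hi => (hrow i hi).1) (fun i hi => (hrow i hi).2.1) (fun i hi => (hrow i hi).2.2)
    (cloud_lcP e₁ e₂ hx hm hB hC hBC hF)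
  -- bookkeeping: the three inner sums are `P1 − pP0`, `P2 − pP1`, `P3 − pP2`
  have e0 : ∑ i ∈ s, m i * (A0 i + ψ0 i ^ 2) = cloudP1 e₁ e₂ s m A B C x - p * cloudP0 e₁ e₂ s m A B C x := by
    unfold cloudP0 cloudP1; rw [Finset.mul_sum, ← Finset.sum_sub_distrib]
    exact Finset.sum_congr rfl fun i _ => by simp only [hA0, hψ0, hψ1]; ring
  have e1 : ∑ i ∈ s, m i * (A1 i + 2 * ψ0 i * ψ1 i) = cloudP2 e₁ e₂ s m A B C x - p * cloudP1 e₁ e₂ s m A B C x := by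
    unfold cloudP1 cloudP2; rw [Finset.mul_sum, ← Finset.sum_sub_distrib]
    exact Finset.sum_congr rfl fun i _ => by simp only [hA1, hψ0, hψ1, hψ2]; ring
  have e2 : ∑ i ∈ s, m i * (A2 i + 2 * ψ1 i ^ 2 + 2 * ψ0 i * ψ2 i)
      = cloudP3 e₁ e₂ s m A B C x - p * cloudP2 e₁ e₂ s m A B C x := by
    unfold cloudP2 cloudP3; rw [Finset.mul_sum, ← Finset.sum_sub_distrib]
    exact Finset.sum_congr rfl fun i _ => by simp only [hA2, hψ0, hψ1, hψ2, hψ3]; ring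
  rw [e0, e1, e2] at h
  convert h using 2 <;> ring

end Cloud

/-! ### §3 The theorem -/

/-- ★★ **ONE SWITCHED TWO-LETTER RISER AGAINST ANY CLOUD OF UNSWITCHED INCOHERENT TRINOMIALS ⇒ AT MOST THREE ZEROS.**
`p = e₁+1 < q = e₁+e₂+2`; riser `b, c > 0` with `a < b x^p + c x^q` on `[x₁, x₄] ⊂ (0,∞)`; nonempty cloud `s`, weights `m_i > 0`, letters
`B_i, C_i ≥ 0` with `B_i + C_i > 0`, unswitched (`A_i − B_i x^p − C_i x^q > 0`) on the interval.  Then `P(x)/(b x^p + c x^q − a) − cloudP0(x)`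
does not vanish at four points `x₁ < x₂ < x₃ < x₄`. [this file's theorem] -/
theorem oneRiser_no_four_zeros_trinomialCloud (e₁ e₂ : ℕ) {a b c : ℝ} (hb : 0 < b) (hc : 0 < c)
    {ι : Type*} (s : Finset ι) (hs : s.Nonempty) (m A B C : ι → ℝ) (hm : ∀ i ∈ s, 0 < m i)
    (hB : ∀ i ∈ s, 0 ≤ B i) (hC : ∀ i ∈ s, 0 ≤ C i) (hBC : ∀ i ∈ s, 0 < B i + C i)
    {x₁ x₂ x₃ x₄ : ℝ} (h0 : 0 < x₁) (h12 : x₁ < x₂) (h23 : x₂ < x₃) (h34 : x₃ < x₄)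
    (hsw : ∀ x ∈ Set.Icc x₁ x₄, a < b * x ^ (e₁ + 1) + c * x ^ (e₁ + e₂ + 2))
    (hun : ∀ x ∈ Set.Icc x₁ x₄, ∀ i ∈ s, 0 < A i - B i * x ^ (e₁ + 1) - C i * x ^ (e₁ + e₂ + 2))
    (hzero : ∀ x ∈ ({x₁, x₂, x₃, x₄} : Set ℝ),
      (((e₁ : ℝ) + 1) * b * x ^ (e₁ + 1) + ((e₁ : ℝ) + e₂ + 2) * c * x ^ (e₁ + e₂ + 2))
          / (b * x ^ (e₁ + 1) + c * x ^ (e₁ + e₂ + 2) - a) - cloudP0 e₁ e₂ s m A B C x = 0) : False := by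
  have hx0 : ∀ x ∈ Set.Icc x₁ x₄, 0 < x := fun x hx => h0.trans_le hx.1
  exact oneRiser_no_four_zeros_of_tower e₁ e₂ hb hc (cloudP0 e₁ e₂ s m A B C) (cloudP1 e₁ e₂ s m A B C)
    (cloudP2 e₁ e₂ s m A B C) (cloudP3 e₁ e₂ s m A B C) h0 h12 h23 h34 hsw
    (fun x hx => (cloud_signs e₁ e₂ (hx0 x hx) hs hm hB hC hBC (hun x hx)).1)
    (fun x hx => (cloud_signs e₁ e₂ (hx0 x hx) hs hm hB hC hBC (hun x hx)).2.1)
    (fun x hx => cloud_hasDerivAt0 e₁ e₂ s m A B C (hx0 x hx) (hun x hx))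
    (fun x hx => cloud_hasDerivAt1 e₁ e₂ s m A B C (hx0 x hx) (hun x hx))
    (fun x hx => cloud_hasDerivAt2 e₁ e₂ s m A B C (hx0 x hx) (hun x hx))
    (fun x hx => cloud_lcP e₁ e₂ (hx0 x hx) hm hB hC hBC (hun x hx))
    (fun x hx => (cloud_signs e₁ e₂ (hx0 x hx) hs hm hB hC hBC (hun x hx)).2.2.2)
    (fun x hx => cloud_lcN e₁ e₂ (hx0 x hx) hm hB hC hBC (hun x hx)) hzero

end ProductPlusOne

end Summit.ValiantsHypothesis.ValiantsHypothesis.Theorems.LacunarySymmetroidMatrixDescartes
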